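import Summits.BirchSwinnertonDyer.BirchSwinnertonDyer.Theorems.PrintCf2RamifiedOffTYZThetaCriterionLeaf
import Summits.BirchSwinnertonDyer.Rank1Residual.P2.KrizLiTwoFortyThreeSlices
import HarnessLib

/-!
# Route `PrintCf2`, crux stmt-BirchSwinnertonDyer-20509 `RamifiedOffTYZOfFacts` — THE CONDUCTOR CUT OF THE RESIDUAL
# (Creutz–Miller / Miller–Stoll BY NAME, seat p4's «leaf after print», p565602) INTEGRATED INTO THE LEAD'S SKELETON:
# the v5 residual stub re-cut into «small conductor» (closable beyond the bundle by aside 20770's fact) and the residual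
# in conductor `≥ 5000` (OPEN, no print); skeleton v6 (cell `bsd-print-cf2`, seat p1 = lead)

HONEST FRAMING (cell `bsd-print-cf2`, run/shared/lean/pub/bsd-print-cf2/; route `PrintCf2`; crux 20509 =
`𝔅_ram → WAllCornerFTwoRamifiedOffTYZProved`, OPEN AS A CLASS): bookkeeping only — no named fact introduced, nothing
asserted, no `def`. Seat p4 (g3) proved that, GRANTED Creutz–Miller / Miller / Miller–Stoll (the statement-only fact
`bsdTriple_of_analyticRank_le_one_of_conductor_lt`, item-stated as aside 20768 and consumed by the CLOSED aside 20770
`SmallConductorOfFacts`), the v5 residual `WAllCornerFTwoRamifiedOffBookedIsogenyOffThetaCriterion` of crux 20509 is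
EQUIVALENT to its restriction to conductor `≥ 5000`
(`PrintCf2.wAllCornerFTwoRamifiedOffBookedIsogenyOffThetaCriterion_iff_largeConductor_of_S31`, file
`Theorems/PrintCf2LeafAfterPrintLargeConductor.lean`). This file turns that cut into the lead's stub currency WITHOUT the
fact: the v5 residual follows from TWO statements — the RAMIFIED SMALL-CONDUCTOR LEAF «CM, `ord_{s=1} L(E,s) = 1`, `2 ∣ d_K`,
`N_E < 5000` ⇒ `BSD(E,2)`» (the ramified restriction of aside 20770's consequent; closable beyond `𝔅_ram` by the one fact
`hS31`, §1) and the LARGE-CONDUCTOR RESIDUAL «CM, `r_an = 1`, `2 ∣ d_K`, isogenous to no booked `E_n`, to no Shu–Zhai twist of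
`256c1`, to no four-prime theta member, to no member of the Θ-criterion class, `N_E ≥ 5000` ⇒ `BSD(E,2)`» (p4's kernel form
VERBATIM; OPEN, no theorem in print) — by excluded middle on `N_E < 5000` (§2). §3 is the composition of skeleton v6 of the
crux (`𝔅_ram` + U⁺ + theta + Shu–Zhai + four-prime theta + Θ-criterion + small conductor + large-conductor residual ⟹
`WAllCornerFTwoRamifiedOffTYZProved`), §4 the Plus-shaped term of the small-conductor stub (antecedent `𝔅_ram ∧ hS31`).
Among the `E_n` classes the cut removes only `n ≤ 12` (`32n² < 5000`); it removes the small quartic twists `y² = x³ + Ax`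
and every other member of conductor `< 5000` (lit DOSSIER §14.2: 140 CM curves / 56 isogeny classes with `r_an = 1`,
`N < 5000`, all types). beyond-print theorem: NO (bookkeeping of what print reaches). No route file imported.
[cite: CreutzMiller2012, Thm. 1.1] [cite: MillerStoll2012, Thm. 9.1] [cite: Miller2011LMS, Def. 1.1 (arXiv:1010.2431 p. 3)]
[cite: KrizLi2019, Rem. 5.2]
-/

noncomputable section

open scoped Classical

open WeierstrassCurve Summit.BirchSwinnertonDyer Summit.BirchSwinnertonDyer.Rank1Residual
  Literature.NumberTheory.EllipticCurves Literature.NumberTheory.EllipticCurves.Rank1Residual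

set_option autoImplicit false

namespace Summit.BirchSwinnertonDyer.PrintCf2

/-! ## §1 The ramified small-conductor leaf: from the fact, and from aside 20770's consequent -/

/-- **The ramified small-conductor leaf from Creutz–Miller / Miller–Stoll BY NAME** (`hS31`): every globally minimal CM
curve of analytic rank one with `2` ramified in `K` and conductor `< 5000` satisfies `BSD(E,2)` (the CM and ramification
hypotheses are idle). [cite: CreutzMiller2012, Thm. 1.1] [cite: MillerStoll2012, Thm. 9.1] -/
theorem ramifiedSmallConductor_of_S31 (hS31 : bsdTriple_of_analyticRank_le_one_of_conductor_lt) :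
    (∀ (W : WeierstrassCurve ℚ) [W.IsElliptic] [W.IsGloballyMinimal],
        W.HasCM → W.analyticRank = 1 → CMRamified W 2 → W.conductorNorm ℤ < 5000 → BSDp W 2) :=
  fun W _ _ _ hr _ hN ↦ Rank1Residual.P2.bsdp_two_of_analyticRank_le_one_of_conductor_lt_5000 hS31 W hr.le hN

/-- **The ramified small-conductor leaf is the ramified restriction of aside 20770's consequent** (`SmallConductorOfFacts`:
CM, `r_an = 1`, `N < 5000` ⇒ `BSD(E,2)`, every type). Pure logic. [cite: CreutzMiller2012, Thm. 1.1] -/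
theorem ramifiedSmallConductor_of_smallConductor
    (h : ∀ (W : WeierstrassCurve ℚ) [W.IsElliptic] [W.IsGloballyMinimal],
      W.HasCM → W.analyticRank = 1 → W.conductorNorm ℤ < 5000 → BSDp W 2) :
    (∀ (W : WeierstrassCurve ℚ) [W.IsElliptic] [W.IsGloballyMinimal],
        W.HasCM → W.analyticRank = 1 → CMRamified W 2 → W.conductorNorm ℤ < 5000 → BSDp W 2) :=
  fun W _ _ hcm hr _ hN ↦ h W hcm hr hN

/-! ## §2 The v5 residual ⟸ small-conductor leaf ∧ large-conductor residual (no fact), and the two projections -/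

/-- **THE CUT (fact-free direction).** The v5 residual `WAllCornerFTwoRamifiedOffBookedIsogenyOffThetaCriterion` of crux 20509
follows from the ramified small-conductor leaf and the residual restricted to conductor `≥ 5000` (seat p4's kernel form,
verbatim) — excluded middle on `N_E < 5000`. [cite: CreutzMiller2012, Thm. 1.1] [cite: Miller2011LMS, Def. 1.1] -/
theorem wAllCornerFTwoRamifiedOffBookedIsogenyOffThetaCriterion_of_smallConductor_of_largeConductor
    (hS : (∀ (W : WeierstrassCurve ℚ) [W.IsElliptic] [W.IsGloballyMinimal],
        W.HasCM → W.analyticRank = 1 → CMRamified W 2 → W.conductorNorm ℤ < 5000 → BSDp W 2))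
    (hL : (∀ (W : WeierstrassCurve ℚ) [W.IsElliptic] [W.IsGloballyMinimal],
        W.HasCM → W.analyticRank = 1 → CMRamified W 2 →
          ¬ CongruentBookedIsogenyClass W → ¬ P2.IsIsogenousToShuZhaiTwoFiftySixTwist W →
          ¬ CongruentThetaFourIsogenyClass W → ¬ CongruentThetaCriterionIsogenyClass W →
          5000 ≤ W.conductorNorm ℤ → BSDp W 2)) :
    WAllCornerFTwoRamifiedOffBookedIsogenyOffThetaCriterion := by
  intro W _ _ hcm hr hram h1 h2 h3 h4
  by_cases hN : W.conductorNorm ℤ < 5000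
  · exact hS W hcm hr hram hN
  · exact hL W hcm hr hram h1 h2 h3 h4 (not_lt.mp hN)

/-- The large-conductor residual is a restriction of the v5 residual (projection). [folklore] -/
theorem largeConductor_of_wAllCornerFTwoRamifiedOffBookedIsogenyOffThetaCriterion
    (h : WAllCornerFTwoRamifiedOffBookedIsogenyOffThetaCriterion) :
    (∀ (W : WeierstrassCurve ℚ) [W.IsElliptic] [W.IsGloballyMinimal],
        W.HasCM → W.analyticRank = 1 → CMRamified W 2 →
          ¬ CongruentBookedIsogenyClass W → ¬ P2.IsIsogenousToShuZhaiTwoFiftySixTwist W →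
          ¬ CongruentThetaFourIsogenyClass W → ¬ CongruentThetaCriterionIsogenyClass W →
          5000 ≤ W.conductorNorm ℤ → BSDp W 2) :=
  fun W _ _ hcm hr hram h1 h2 h3 h4 _ ↦ h W hcm hr hram h1 h2 h3 h4

/-- The ramified small-conductor leaf is a restriction of the ramified slice `WAllCornerFTwoRamified` (projection), hence of
the whole leaf. [folklore] -/
theorem ramifiedSmallConductor_of_wAllCornerFTwoRamified (h : WAllCornerFTwoRamified) :
    (∀ (W : WeierstrassCurve ℚ) [W.IsElliptic] [W.IsGloballyMinimal],
        W.HasCM → W.analyticRank = 1 → CMRamified W 2 → W.conductorNorm ℤ < 5000 → BSDp W 2) :=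
  fun W _ _ hcm hr hram _ ↦ h W hcm hr hram

/-! ## §3 Skeleton v6 of crux 20509: the v5 residual stub re-cut, and the composition -/

/-- **The v5 residual stub `stub_offTYZ_residual` (𝔅_ram ⟹ `WAllCornerFTwoRamifiedOffBookedIsogenyOffThetaCriterion`) is CUT**:
it follows from «𝔅_ram ⟹ ramified small-conductor leaf» (closable beyond the bundle by `hS31`, §1/§4; twin aside 20770 CLOSED)
and «𝔅_ram ⟹ the residual in conductor `≥ 5000`» (OPEN, no print). [folklore] -/
theorem stub_offTYZ_residual_of_smallConductor_of_offLarge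
    (hS : (Literature.NumberTheory.EllipticCurves.rank_eq_analyticRank_of_analyticRank_le_one ∧ WeierstrassCurve.hasEntireLFunction_rat ∧ WeierstrassCurve.bsdRHS_eq_of_isIsogenous ∧ Literature.NumberTheory.EllipticCurves.bsdTriple_of_hasCM_of_L_one_ne_zero ∧ Literature.NumberTheory.EllipticCurves.TianYuanZhang2017.thm12_parity_of_scriptL' ∧ Literature.NumberTheory.EllipticCurves.Tian2014.thm13_rank_one_and_sha_odd ∧ Literature.NumberTheory.QuadraticFields.RedeiReichardt.redeiReichardt_fourTwoCard_classGroup ∧ Literature.NumberTheory.EllipticCurves.LiLiuTian2024.thm12_bsd_congruentNumberCurve ∧ Literature.NumberTheory.EllipticCurves.Monsky1990.cor515_rank_eq_one_and_card_selmerGroup_two ∧ Literature.NumberTheory.EllipticCurves.HeathBrown1994.monsky_card_selmerGroup_two_even ∧ Literature.NumberTheory.EllipticCurves.Tian2014.tian2014_system_sMinus_genus) → (∀ (W : WeierstrassCurve ℚ) [W.IsElliptic] [W.IsGloballyMinimal],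
        W.HasCM → W.analyticRank = 1 → CMRamified W 2 → W.conductorNorm ℤ < 5000 → BSDp W 2))
    (hO : (Literature.NumberTheory.EllipticCurves.rank_eq_analyticRank_of_analyticRank_le_one ∧ WeierstrassCurve.hasEntireLFunction_rat ∧ WeierstrassCurve.bsdRHS_eq_of_isIsogenous ∧ Literature.NumberTheory.EllipticCurves.bsdTriple_of_hasCM_of_L_one_ne_zero ∧ Literature.NumberTheory.EllipticCurves.TianYuanZhang2017.thm12_parity_of_scriptL' ∧ Literature.NumberTheory.EllipticCurves.Tian2014.thm13_rank_one_and_sha_odd ∧ Literature.NumberTheory.QuadraticFields.RedeiReichardt.redeiReichardt_fourTwoCard_classGroup ∧ Literature.NumberTheory.EllipticCurves.LiLiuTian2024.thm12_bsd_congruentNumberCurve ∧ Literature.NumberTheory.EllipticCurves.Monsky1990.cor515_rank_eq_one_and_card_selmerGroup_two ∧ Literature.NumberTheory.EllipticCurves.HeathBrown1994.monsky_card_selmerGroup_two_even ∧ Literature.NumberTheory.EllipticCurves.Tian2014.tian2014_system_sMinus_genus) → (∀ (W : WeierstrassCurve ℚ) [W.IsElliptic] [W.IsGloballyMinimal],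
        W.HasCM → W.analyticRank = 1 → CMRamified W 2 →
          ¬ CongruentBookedIsogenyClass W → ¬ P2.IsIsogenousToShuZhaiTwoFiftySixTwist W →
          ¬ CongruentThetaFourIsogenyClass W → ¬ CongruentThetaCriterionIsogenyClass W →
          5000 ≤ W.conductorNorm ℤ → BSDp W 2)) :
    (Literature.NumberTheory.EllipticCurves.rank_eq_analyticRank_of_analyticRank_le_one ∧ WeierstrassCurve.hasEntireLFunction_rat ∧ WeierstrassCurve.bsdRHS_eq_of_isIsogenous ∧ Literature.NumberTheory.EllipticCurves.bsdTriple_of_hasCM_of_L_one_ne_zero ∧ Literature.NumberTheory.EllipticCurves.TianYuanZhang2017.thm12_parity_of_scriptL' ∧ Literature.NumberTheory.EllipticCurves.Tian2014.thm13_rank_one_and_sha_odd ∧ Literature.NumberTheory.QuadraticFields.RedeiReichardt.redeiReichardt_fourTwoCard_classGroup ∧ Literature.NumberTheory.EllipticCurves.LiLiuTian2024.thm12_bsd_congruentNumberCurve ∧ Literature.NumberTheory.EllipticCurves.Monsky1990.cor515_rank_eq_one_and_card_selmerGroup_two ∧ Literature.NumberTheory.EllipticCurves.HeathBrown1994.monsky_card_selmerGroup_two_even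 ∧ Literature.NumberTheory.EllipticCurves.Tian2014.tian2014_system_sMinus_genus) → Summit.BirchSwinnertonDyer.WAllCornerFTwoRamifiedOffBookedIsogenyOffThetaCriterion :=
  fun hB ↦ wAllCornerFTwoRamifiedOffBookedIsogenyOffThetaCriterion_of_smallConductor_of_largeConductor (hS hB) (hO hB)

/-- **Crux 20509's conclusion from the bundle, the six beyond-bundle leaves and the large-conductor residual off them** — the
composition `RamifiedOffTYZOfFacts_of` of the lead's skeleton v6: U⁺ (`hU`, aside 20471), theta (`hT`, 21185), Shu–Zhai `256c1`
(`hZ`, 21183/21395), four-prime theta (`hT4`, 21427), Θ-criterion (`hTC`, 21428), ramified small conductor (`hS`, 20770),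
large-conductor residual (`hO`, OPEN). [folklore] -/
theorem offTYZProved_of_bundle_of_uPlus_of_theta_of_shuZhai_of_thetaFour_of_thetaCriterion_of_smallConductor_of_offLarge
    (hB : (Literature.NumberTheory.EllipticCurves.rank_eq_analyticRank_of_analyticRank_le_one ∧ WeierstrassCurve.hasEntireLFunction_rat ∧ WeierstrassCurve.bsdRHS_eq_of_isIsogenous ∧ Literature.NumberTheory.EllipticCurves.bsdTriple_of_hasCM_of_L_one_ne_zero ∧ Literature.NumberTheory.EllipticCurves.TianYuanZhang2017.thm12_parity_of_scriptL' ∧ Literature.NumberTheory.EllipticCurves.Tian2014.thm13_rank_one_and_sha_odd ∧ Literature.NumberTheory.QuadraticFields.RedeiReichardt.redeiReichardt_fourTwoCard_classGroup ∧ Literature.NumberTheory.EllipticCurves.LiLiuTian2024.thm12_bsd_congruentNumberCurve ∧ Literature.NumberTheory.EllipticCurves.Monsky1990.cor515_rank_eq_one_and_card_selmerGroup_two ∧ Literature.NumberTheory.EllipticCurves.HeathBrown1994.monsky_card_selmerGroup_two_even ∧ Literature.NumberTheory.EllipticCurves.Tian2014.tian2014_system_sMinus_genus))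
    (hU : WAllCornerFTwoRamifiedTYZUPlus) (hT : WAllCornerFTwoRamifiedTheta)
    (hZ : WAllCornerFTwoRamifiedShuZhaiTwoFiftySix) (hT4 : WAllCornerFTwoRamifiedThetaFour)
    (hTC : WAllCornerFTwoRamifiedThetaCriterion)
    (hS : (∀ (W : WeierstrassCurve ℚ) [W.IsElliptic] [W.IsGloballyMinimal],
        W.HasCM → W.analyticRank = 1 → CMRamified W 2 → W.conductorNorm ℤ < 5000 → BSDp W 2))
    (hO : (∀ (W : WeierstrassCurve ℚ) [W.IsElliptic] [W.IsGloballyMinimal],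
        W.HasCM → W.analyticRank = 1 → CMRamified W 2 →
          ¬ CongruentBookedIsogenyClass W → ¬ P2.IsIsogenousToShuZhaiTwoFiftySixTwist W →
          ¬ CongruentThetaFourIsogenyClass W → ¬ CongruentThetaCriterionIsogenyClass W →
          5000 ≤ W.conductorNorm ℤ → BSDp W 2)) :
    WAllCornerFTwoRamifiedOffTYZProved :=
  offTYZProved_of_bundle_of_uPlus_of_theta_of_shuZhai_of_thetaFour_of_thetaCriterion_of_off hB hU hT hZ hT4 hTC
    (wAllCornerFTwoRamifiedOffBookedIsogenyOffThetaCriterion_of_smallConductor_of_largeConductor hS hO)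

/-! ## §4 The small-conductor stub beyond the bundle: the Plus-shaped term -/

/-- **The ramified small-conductor leaf from the bundle PLUS Creutz–Miller / Miller–Stoll** — the term a `…OfFactsPlus` twin
of the stub would be closed by (antecedent `𝔅_ram ∧ bsdTriple_of_analyticRank_le_one_of_conductor_lt`; only the extra
conjunct is used; the all-type form is the CLOSED aside 20770). [cite: CreutzMiller2012, Thm. 1.1] [cite: MillerStoll2012, Thm. 9.1] -/
theorem ramifiedSmallConductor_of_bundlePlus
    (h : (Literature.NumberTheory.EllipticCurves.rank_eq_analyticRank_of_analyticRank_le_one ∧ WeierstrassCurve.hasEntireLFunction_rat ∧ WeierstrassCurve.bsdRHS_eq_of_isIsogenous ∧ Literature.NumberTheory.EllipticCurves.bsdTriple_of_hasCM_of_L_one_ne_zero ∧ Literature.NumberTheory.EllipticCurves.TianYuanZhang2017.thm12_parity_of_scriptL' ∧ Literature.NumberTheory.EllipticCurves.Tian2014.thm13_rank_one_and_sha_odd ∧ Literature.NumberTheory.QuadraticFields.RedeiReichardt.redeiReichardt_fourTwoCard_classGroup ∧ Literature.NumberTheory.EllipticCurves.LiLiuTian2024.thm12_bsd_congruentNumberCurve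 ∧ Literature.NumberTheory.EllipticCurves.Monsky1990.cor515_rank_eq_one_and_card_selmerGroup_two ∧ Literature.NumberTheory.EllipticCurves.HeathBrown1994.monsky_card_selmerGroup_two_even ∧ Literature.NumberTheory.EllipticCurves.Tian2014.tian2014_system_sMinus_genus) ∧
      Literature.NumberTheory.EllipticCurves.bsdTriple_of_analyticRank_le_one_of_conductor_lt) :
    (∀ (W : WeierstrassCurve ℚ) [W.IsElliptic] [W.IsGloballyMinimal],
        W.HasCM → W.analyticRank = 1 → CMRamified W 2 → W.conductorNorm ℤ < 5000 → BSDp W 2) :=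
  ramifiedSmallConductor_of_S31 h.2

end Summit.BirchSwinnertonDyer.PrintCf2

end
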